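import Literature.NumberTheory.NumberFields.IntegralBasisCriterion
import Mathlib.NumberTheory.NumberField.Basic
import Mathlib.FieldTheory.PrimitiveElement
import Mathlib.RingTheory.Polynomial.GaussLemma
import Mathlib.Algebra.CubicDiscriminant
import Mathlib.Tactic.ComputeDegree
import HarnessLib

/-!
# Explicit cubic number fields `K = ℚ(θ)`, `θ³ + aθ² + bθ + c = 0`: power basis, trace, norm, discriminant

Topic `NumberTheory/NumberFields`, sub-namespace `MonicCubic` (the object: a cubic field
presented by a root of a monic integer cubic; named so as not to shadow Mathlib's `Cubic`, to
which `poly_eq_toPoly` / `disc_eq_discr` bridge). For a number field `K` of degree `3` containing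
a root `θ` of an irreducible monic `f = X³ + aX² + bX + c ∈ ℤ[X]`, this file makes the classical
hand computations available as theorems (D. A. Marcus, *Number Fields*, 2nd ed. (2018), Ch. 2, Thms. 4–8 and
exercises 13–17: trace and norm as matrix trace / determinant of multiplication, discriminant of
`1, θ, θ²` as the determinant of the trace form):

* `MonicCubic.poly a b c`, `MonicCubic.polyQ`,
  `MonicCubic.disc a b c = a²b² - 4b³ - 4a³c - 27c² + 18abc` (`= Cubic.discr ⟨1,a,b,c⟩`),
  `MonicCubic.companion` (matrix of multiplication by `θ` on `1, θ, θ²`),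
  `MonicCubic.normForm a b c x y z` (the cubic form `N(x + yθ + zθ²)`), all explicit;
* `MonicCubic.pb`, `MonicCubic.basis` (`= θ^i`), `leftMulMatrix_theta`, `leftMulMatrix_lin`,
  `trace_lin` (`Tr(x + yθ + zθ²) = 3x - ay + (a² - 2b)z`), `norm_lin`
  (`N(x + yθ + zθ²) = normForm a b c x y z`), `discr_basis = disc a b c`, `discr_pb`;
* integrality: `thetaInt : 𝓞 K`, `thetaInt_rel`, `minpoly_thetaInt`.

Written for the explicit `2`-descents over the four cyclic cubic fields of
`Literature/Barriers/BirchSwinnertonDyer/RankNotSumOfLocalInvariantsF3Cubic*.lean`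
(T. Dokchitser–V. Dokchitser, J. Number Theory 131 (2011), proof of Thm. 2), in the style of the
tree's `Literature/Topology/FourManifolds/CappellShanesonClassNumberOne.lean` (the family
`X³ - aX² + (a-1)X - 1`), but for an arbitrary monic integer cubic. Everything is proved.

## References

* [Marcus2018] D. A. Marcus, *Number Fields*, 2nd ed., Universitext, Springer (2018), Ch. 2
  (trace, norm, discriminant; Exercise 27 for the index criterion used downstream).
-/

noncomputable section

open Polynomial Module NumberField IntermediateField
open scoped NumberField

namespace Literature.NumberTheory.NumberFields

namespace MonicCubic

/-! ### The polynomial and its invariants -/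

/-- The monic integer cubic `f = X³ + aX² + bX + c`. [folklore] -/
def poly (a b c : ℤ) : ℤ[X] := X ^ 3 + C a * X ^ 2 + C b * X + C c

/-- `poly a b c` is Mathlib's `Cubic.toPoly` of `⟨1, a, b, c⟩` (kept as an explicit body for
`simp`/`compute_degree`; this bridges to `Mathlib/Algebra/CubicDiscriminant.lean`). [folklore] -/
theorem poly_eq_toPoly (a b c : ℤ) : poly a b c = (Cubic.mk 1 a b c).toPoly := by
  simp [poly, Cubic.toPoly]

/-- `f` is monic. [folklore] -/
theorem monic_poly (a b c : ℤ) : (poly a b c).Monic := by unfold poly; monicity!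

/-- `f` has degree `3`. [folklore] -/
theorem natDegree_poly (a b c : ℤ) : (poly a b c).natDegree = 3 := by
  unfold poly; compute_degree!

/-- `f` over `ℚ`. [folklore] -/
def polyQ (a b c : ℤ) : ℚ[X] := (poly a b c).map (algebraMap ℤ ℚ)

/-- `f` over `ℚ`, written out. [folklore] -/
theorem polyQ_eq (a b c : ℤ) :
    polyQ a b c = X ^ 3 + C (a : ℚ) * X ^ 2 + C (b : ℚ) * X + C (c : ℚ) := by
  simp [polyQ, poly, Polynomial.map_add, Polynomial.map_mul, Polynomial.map_pow]

/-- `f` over `ℚ` is monic. [folklore] -/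
theorem monic_polyQ (a b c : ℤ) : (polyQ a b c).Monic := (monic_poly a b c).map _

/-- `f` over `ℚ` has degree `3`. [folklore] -/
theorem natDegree_polyQ (a b c : ℤ) : (polyQ a b c).natDegree = 3 := by
  rw [polyQ, (monic_poly a b c).natDegree_map, natDegree_poly]

/-- The discriminant `Δ(f) = a²b² - 4b³ - 4a³c - 27c² + 18abc` of `X³ + aX² + bX + c`.
[cite: Marcus2018, Ch. 2, Exercise 17] -/
def disc (a b c : ℤ) : ℤ :=
  a ^ 2 * b ^ 2 - 4 * b ^ 3 - 4 * a ^ 3 * c - 27 * c ^ 2 + 18 * a * b * c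

/-- `disc a b c` is Mathlib's `Cubic.discr` of `⟨1, a, b, c⟩` (so that e.g.
`Cubic.discr_eq_prod_three_roots` applies). [folklore] -/
theorem disc_eq_discr (a b c : ℤ) : disc a b c = (Cubic.mk 1 a b c).discr := by
  simp [disc, Cubic.discr]

/-- The companion matrix of `f`: multiplication by `θ` on the basis `1, θ, θ²` (columns = the
coordinates of `θ, θ², θ³ = -c - bθ - aθ²`). [folklore] -/
def companion (a b c : ℤ) : Matrix (Fin 3) (Fin 3) ℚ :=
  !![0, 0, -(c : ℚ); 1, 0, -(b : ℚ); 0, 1, -(a : ℚ)]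

/-- The norm form of `f`: `N(x + yθ + zθ²) = ∏ᵢ (x + yθᵢ + zθᵢ²)` over the roots `θᵢ`, as an
explicit cubic form in `x, y, z`. [cite: Marcus2018, Ch. 2, Thm. 4 and Exercise 13] -/
def normForm (a b c : ℤ) (x y z : ℚ) : ℚ :=
  x ^ 3 - a * x ^ 2 * y + (a ^ 2 - 2 * b) * x ^ 2 * z + b * x * y ^ 2 +
    (3 * c - a * b) * x * y * z + (b ^ 2 - 2 * a * c) * x * z ^ 2 - c * y ^ 3 +
    a * c * y ^ 2 * z - b * c * y * z ^ 2 + c ^ 2 * z ^ 3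

/-! ### A cubic field generated by a root -/

section Root

variable {K : Type*} [Field K] [NumberField K] {a b c : ℤ} {θ : K}

/-- A root of `f` is a root of `f` over `ℚ`. [folklore] -/
theorem aeval_polyQ (hθ : aeval θ (poly a b c) = 0) : aeval θ (polyQ a b c) = 0 := by
  rw [polyQ, aeval_map_algebraMap]; exact hθ

omit [NumberField K] in
/-- The cubic relation `θ³ + aθ² + bθ + c = 0` in `K`. [folklore] -/
theorem theta_rel (hθ : aeval θ (poly a b c) = 0) :
    θ ^ 3 + (a : K) * θ ^ 2 + (b : K) * θ + (c : K) = 0 := by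
  have := hθ
  simp only [poly, map_add, map_mul, map_pow, aeval_X, eq_intCast, map_intCast] at this
  linear_combination this

omit [NumberField K] in
/-- A root of the monic integer cubic `f` is an algebraic integer. [folklore] -/
theorem isIntegral_of_aeval (hθ : aeval θ (poly a b c) = 0) : IsIntegral ℤ θ :=
  ⟨poly a b c, monic_poly a b c, hθ⟩

/-- The minimal polynomial over `ℚ` of a root of an irreducible `f` is `f`. [folklore] -/
theorem minpoly_rat_eq (hirr : Irreducible (polyQ a b c)) (hθ : aeval θ (poly a b c) = 0) :
    minpoly ℚ θ = polyQ a b c :=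
  (minpoly.eq_of_irreducible_of_monic hirr (aeval_polyQ hθ) (monic_polyQ a b c)).symm

/-- The minimal polynomial over `ℤ` of a root of an irreducible `f` is `f`. [folklore] -/
theorem minpoly_int_eq (hirr : Irreducible (polyQ a b c)) (hθ : aeval θ (poly a b c) = 0) :
    minpoly ℤ θ = poly a b c := by
  apply Polynomial.map_injective (algebraMap ℤ ℚ) (algebraMap ℤ ℚ).injective_int
  rw [← minpoly.isIntegrallyClosed_eq_field_fractions' ℚ (isIntegral_of_aeval hθ),
    minpoly_rat_eq hirr hθ]
  rfl

/-- `ℚ(θ) = K` when `[K : ℚ] = 3` and `f` is irreducible. [folklore] -/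
theorem adjoin_root_eq_top (hirr : Irreducible (polyQ a b c)) (hθ : aeval θ (poly a b c) = 0)
    (h3 : finrank ℚ K = 3) : ℚ⟮θ⟯ = ⊤ :=
  (Field.primitive_element_iff_minpoly_natDegree_eq ℚ θ).mpr
    (by rw [minpoly_rat_eq hirr hθ, natDegree_polyQ, h3])

/-- The power basis `1, θ, θ²` of `K = ℚ(θ)`. [folklore] -/
def pb (hirr : Irreducible (polyQ a b c)) (hθ : aeval θ (poly a b c) = 0)
    (h3 : finrank ℚ K = 3) : PowerBasis ℚ K :=
  (adjoin.powerBasis (isIntegral_of_aeval hθ).tower_top).map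
    ((equivOfEq (adjoin_root_eq_top hirr hθ h3)).trans topEquiv)

/-- The generator of `pb` is `θ`. [folklore] -/
theorem pb_gen (hirr : Irreducible (polyQ a b c)) (hθ : aeval θ (poly a b c) = 0)
    (h3 : finrank ℚ K = 3) : (pb hirr hθ h3).gen = θ := rfl

/-- `pb` has dimension `3`. [folklore] -/
theorem pb_dim (hirr : Irreducible (polyQ a b c)) (hθ : aeval θ (poly a b c) = 0)
    (h3 : finrank ℚ K = 3) : (pb hirr hθ h3).dim = 3 := by
  rw [pb, PowerBasis.map_dim, adjoin.powerBasis_dim, minpoly_rat_eq hirr hθ, natDegree_polyQ]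

/-- The basis `1, θ, θ²` indexed by `Fin 3`. [folklore] -/
def basis (hirr : Irreducible (polyQ a b c)) (hθ : aeval θ (poly a b c) = 0)
    (h3 : finrank ℚ K = 3) : Basis (Fin 3) ℚ K :=
  (pb hirr hθ h3).basis.reindex (finCongr (pb_dim hirr hθ h3))

/-- `basis i = θ ^ i`. [folklore] -/
theorem basis_apply (hirr : Irreducible (polyQ a b c)) (hθ : aeval θ (poly a b c) = 0)
    (h3 : finrank ℚ K = 3) (i : Fin 3) : basis hirr hθ h3 i = θ ^ (i : ℕ) := by
  rw [basis, Basis.reindex_apply, (pb hirr hθ h3).coe_basis, pb_gen]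
  rfl

/-- `θ³ = -c - bθ - aθ²` in the basis `1, θ, θ²`. [folklore] -/
theorem pow_three_eq (hirr : Irreducible (polyQ a b c)) (hθ : aeval θ (poly a b c) = 0)
    (h3 : finrank ℚ K = 3) :
    θ ^ 3 = (-(c : ℚ)) • basis hirr hθ h3 0 + (-(b : ℚ)) • basis hirr hθ h3 1 +
      (-(a : ℚ)) • basis hirr hθ h3 2 := by
  have h := theta_rel hθ
  simp only [basis_apply, Fin.val_zero, Fin.val_one, Fin.val_two, pow_zero, pow_one,
    Algebra.smul_def, map_neg, map_intCast]
  linear_combination h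

/-- Coordinates of `θ` in `1, θ, θ²`. [folklore] -/
theorem repr_pow_one (hirr : Irreducible (polyQ a b c)) (hθ : aeval θ (poly a b c) = 0)
    (h3 : finrank ℚ K = 3) : (basis hirr hθ h3).repr (θ ^ 1) = Finsupp.single 1 1 := by
  rw [show θ ^ 1 = basis hirr hθ h3 1 by rw [basis_apply]; rfl, Basis.repr_self]

/-- Coordinates of `θ²` in `1, θ, θ²`. [folklore] -/
theorem repr_pow_two (hirr : Irreducible (polyQ a b c)) (hθ : aeval θ (poly a b c) = 0)
    (h3 : finrank ℚ K = 3) : (basis hirr hθ h3).repr (θ ^ 2) = Finsupp.single 2 1 := by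
  rw [show θ ^ 2 = basis hirr hθ h3 2 by rw [basis_apply]; rfl, Basis.repr_self]

/-- Coordinates of `θ³` in `1, θ, θ²`. [folklore] -/
theorem repr_pow_three (hirr : Irreducible (polyQ a b c)) (hθ : aeval θ (poly a b c) = 0)
    (h3 : finrank ℚ K = 3) :
    (basis hirr hθ h3).repr (θ ^ 3) =
      Finsupp.single 0 (-(c : ℚ)) + Finsupp.single 1 (-(b : ℚ)) +
        Finsupp.single 2 (-(a : ℚ)) := by
  rw [pow_three_eq hirr hθ h3]
  simp only [map_add, map_smul, Basis.repr_self, Finsupp.smul_single_one]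

/-- Multiplication by `θ` has matrix `companion a b c` in the basis `1, θ, θ²`. [folklore] -/
theorem leftMulMatrix_theta (hirr : Irreducible (polyQ a b c)) (hθ : aeval θ (poly a b c) = 0)
    (h3 : finrank ℚ K = 3) :
    Algebra.leftMulMatrix (basis hirr hθ h3) θ = companion a b c := by
  ext i j
  rw [Algebra.leftMulMatrix_eq_repr_mul, basis_apply, ← pow_succ']
  fin_cases j
  · change ((basis hirr hθ h3).repr (θ ^ 1)) i = companion a b c i 0
    rw [repr_pow_one]
    fin_cases i <;> simp [companion]
  · change ((basis hirr hθ h3).repr (θ ^ 2)) i = companion a b c i 1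
    rw [repr_pow_two]
    fin_cases i <;> simp [companion]
  · change ((basis hirr hθ h3).repr (θ ^ 3)) i = companion a b c i 2
    rw [repr_pow_three]
    fin_cases i <;> simp [companion]

/-- `Tr(θᵏ) = tr(Cᵏ)`. [cite: Marcus2018, Ch. 2, Thm. 4] -/
theorem trace_theta_pow (hirr : Irreducible (polyQ a b c)) (hθ : aeval θ (poly a b c) = 0)
    (h3 : finrank ℚ K = 3) (k : ℕ) :
    Algebra.trace ℚ K (θ ^ k) = Matrix.trace (companion a b c ^ k) := by
  rw [Algebra.trace_eq_matrix_trace (basis hirr hθ h3), map_pow, leftMulMatrix_theta]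

/-- **`disc(1, θ, θ²) = Δ(f)`**, computed as the determinant of the trace form.
[cite: Marcus2018, Ch. 2, Thm. 8 and Exercise 17] -/
theorem discr_basis (hirr : Irreducible (polyQ a b c)) (hθ : aeval θ (poly a b c) = 0)
    (h3 : finrank ℚ K = 3) : Algebra.discr ℚ ⇑(basis hirr hθ h3) = (disc a b c : ℚ) := by
  rw [Algebra.discr_def, Matrix.det_fin_three]
  simp only [Algebra.traceMatrix_apply, Algebra.traceForm_apply, basis_apply, ← pow_add,
    trace_theta_pow hirr hθ h3]
  simp [companion, pow_succ, Matrix.trace_fin_three, disc]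
  ring

/-- **`disc(1, θ, θ²) = Δ(f)`** for the power basis `pb`.
[cite: Marcus2018, Ch. 2, Thm. 8 and Exercise 17] -/
theorem discr_pb (hirr : Irreducible (polyQ a b c)) (hθ : aeval θ (poly a b c) = 0)
    (h3 : finrank ℚ K = 3) :
    Algebra.discr ℚ ⇑(pb hirr hθ h3).basis = (disc a b c : ℚ) := by
  rw [← discr_basis hirr hθ h3, basis, Basis.coe_reindex, Algebra.discr_reindex]

/-- Multiplication by `x + yθ + zθ²` has matrix `x·1 + y·C + z·C²`. [cite: Marcus2018, Ch. 2, Thm. 4] -/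
theorem leftMulMatrix_lin (hirr : Irreducible (polyQ a b c)) (hθ : aeval θ (poly a b c) = 0)
    (h3 : finrank ℚ K = 3) (x y z : ℚ) :
    Algebra.leftMulMatrix (basis hirr hθ h3) ((x : K) + (y : K) * θ + (z : K) * θ ^ 2) =
      x • (1 : Matrix (Fin 3) (Fin 3) ℚ) + y • companion a b c +
        z • companion a b c ^ 2 := by
  have hx : (x : K) = algebraMap ℚ K x := rfl
  have hy : (y : K) * θ = y • θ := (Algebra.smul_def y θ).symm
  have hz : (z : K) * θ ^ 2 = z • θ ^ 2 := (Algebra.smul_def z (θ ^ 2)).symm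
  rw [hx, hy, hz, map_add, map_add, AlgHom.commutes, map_smul, map_smul, map_pow,
    leftMulMatrix_theta, Algebra.algebraMap_eq_smul_one]

/-- **The trace of a general element**: `Tr(x + yθ + zθ²) = 3x - ay + (a² - 2b)z`.
[cite: Marcus2018, Ch. 2, Thm. 4] -/
theorem trace_lin (hirr : Irreducible (polyQ a b c)) (hθ : aeval θ (poly a b c) = 0)
    (h3 : finrank ℚ K = 3) (x y z : ℚ) :
    Algebra.trace ℚ K ((x : K) + (y : K) * θ + (z : K) * θ ^ 2) =
      3 * x - a * y + (a ^ 2 - 2 * b) * z := by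
  rw [Algebra.trace_eq_matrix_trace (basis hirr hθ h3), leftMulMatrix_lin hirr hθ h3]
  simp [companion, pow_succ, Matrix.trace_fin_three]
  ring

/-- **The norm of a general element**: `N(x + yθ + zθ²) = normForm a b c x y z`
(determinant of `x·1 + y·C + z·C²`). [cite: Marcus2018, Ch. 2, Thm. 4 and Exercise 13] -/
theorem norm_lin (hirr : Irreducible (polyQ a b c)) (hθ : aeval θ (poly a b c) = 0)
    (h3 : finrank ℚ K = 3) (x y z : ℚ) :
    Algebra.norm ℚ ((x : K) + (y : K) * θ + (z : K) * θ ^ 2) = normForm a b c x y z := by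
  rw [Algebra.norm_eq_matrix_det (basis hirr hθ h3), leftMulMatrix_lin hirr hθ h3,
    Matrix.det_fin_three]
  simp [companion, pow_succ, Matrix.add_apply, Matrix.smul_apply, normForm]
  ring

/-! ### `θ` as an algebraic integer -/

/-- A root of `f`, as an element of `𝓞 K`. [folklore] -/
def thetaInt (hθ : aeval θ (poly a b c) = 0) : 𝓞 K := ⟨θ, isIntegral_of_aeval hθ⟩

omit [NumberField K] in
/-- The underlying element of `thetaInt hθ` is `θ`. [folklore] -/
@[simp] theorem coe_thetaInt (hθ : aeval θ (poly a b c) = 0) :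
    ((thetaInt hθ : 𝓞 K) : K) = θ := rfl

/-- `thetaInt hθ` is a root of `f` in `𝓞 K`. [folklore] -/
theorem aeval_thetaInt (hθ : aeval θ (poly a b c) = 0) :
    aeval (thetaInt hθ) (poly a b c) = 0 := by
  apply IsFractionRing.injective (𝓞 K) K
  rw [map_zero, ← aeval_algebraMap_apply]
  exact hθ

/-- The cubic relation in `𝓞 K`. [folklore] -/
theorem thetaInt_rel (hθ : aeval θ (poly a b c) = 0) :
    (thetaInt hθ) ^ 3 + (a : 𝓞 K) * (thetaInt hθ) ^ 2 + (b : 𝓞 K) * thetaInt hθ +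
      (c : 𝓞 K) = 0 := by
  have := aeval_thetaInt hθ
  simp only [poly, map_add, map_mul, map_pow, aeval_X, eq_intCast, map_intCast] at this
  linear_combination this

/-- `minpoly_ℤ (thetaInt hθ) = f`. [folklore] -/
theorem minpoly_thetaInt (hirr : Irreducible (polyQ a b c)) (hθ : aeval θ (poly a b c) = 0) :
    minpoly ℤ (thetaInt hθ) = poly a b c := by
  rw [← minpoly.algebraMap_eq (IsFractionRing.injective (𝓞 K) K) (thetaInt hθ)]
  exact minpoly_int_eq hirr hθ

/-- The generator of `pb` is integral. [folklore] -/
theorem isIntegral_pb_gen (hirr : Irreducible (polyQ a b c)) (hθ : aeval θ (poly a b c) = 0)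
    (h3 : finrank ℚ K = 3) : IsIntegral ℤ (pb hirr hθ h3).gen :=
  isIntegral_of_aeval hθ

/-- **`𝓞 K = ℤ[θ]` from the square-factor condition on `Δ(f)`** (Marcus, Ex. 2.27: if every
factorisation `Δ(f) = r²e` with `|e| > 2` has `r = ±1`, then `1, θ, θ²` is an integral basis):
every algebraic integer of `K` lies in `ℤ[θ]`. [cite: Marcus2018, Ch. 2, Exercise 27] -/
theorem mem_adjoin_theta (hirr : Irreducible (polyQ a b c)) (hθ : aeval θ (poly a b c) = 0)
    (h3 : finrank ℚ K = 3) (hsq : ∀ r e : ℤ, disc a b c = r ^ 2 * e → 2 < |e| → IsUnit r)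
    (x : 𝓞 K) : (x : K) ∈ Algebra.adjoin ℤ ({θ} : Set K) :=
  mem_adjoin_of_isUnit_indexDet (pb hirr hθ h3) (isIntegral_pb_gen hirr hθ h3)
    (isUnit_indexDet_of_discr_eq (pb hirr hθ h3) (isIntegral_pb_gen hirr hθ h3)
      (by rw [h3]; norm_num) (disc a b c) (discr_pb hirr hθ h3) hsq) x

/-- **`d_K = Δ(f)`** under the same condition. [cite: Marcus2018, Ch. 2, Exercise 27] -/
theorem discr_eq_disc (hirr : Irreducible (polyQ a b c)) (hθ : aeval θ (poly a b c) = 0)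
    (h3 : finrank ℚ K = 3)
    (hsq : ∀ r e : ℤ, disc a b c = r ^ 2 * e → 2 < |e| → IsUnit r) :
    NumberField.discr K = disc a b c :=
  discr_eq_of_isUnit_indexDet (pb hirr hθ h3) (isIntegral_pb_gen hirr hθ h3)
    (isUnit_indexDet_of_discr_eq (pb hirr hθ h3) (isIntegral_pb_gen hirr hθ h3)
      (by rw [h3]; norm_num) (disc a b c) (discr_pb hirr hθ h3) hsq) (disc a b c)
    (discr_pb hirr hθ h3)

/-- **`ℤ[θ] = 𝓞 K` inside `𝓞 K`** under the same condition. [cite: Marcus2018, Ch. 2, Exercise 27] -/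
theorem adjoin_thetaInt_eq_top (hirr : Irreducible (polyQ a b c)) (hθ : aeval θ (poly a b c) = 0)
    (h3 : finrank ℚ K = 3)
    (hsq : ∀ r e : ℤ, disc a b c = r ^ 2 * e → 2 < |e| → IsUnit r) :
    Algebra.adjoin ℤ ({thetaInt hθ} : Set (𝓞 K)) = ⊤ := by
  refine Algebra.eq_top_iff.mpr fun x => ?_
  have hx := mem_adjoin_theta hirr hθ h3 hsq x
  rw [Algebra.adjoin_singleton_eq_range_aeval] at hx ⊢
  obtain ⟨g, hg⟩ := hx
  refine ⟨g, ?_⟩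
  apply IsFractionRing.injective (𝓞 K) K
  change algebraMap (𝓞 K) K (aeval (thetaInt hθ) g) = (x : K)
  rw [← aeval_algebraMap_apply]
  exact hg

end Root

end MonicCubic

end Literature.NumberTheory.NumberFields
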